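import Mathlib.GroupTheory.PGroup
import Mathlib.Algebra.CharP.Basic
import Mathlib.Algebra.BigOperators.Group.Finset.Basic
import HarnessLib

/-!
# Weighted orbit counting modulo `p`

Helper for the crux `HessianRankCodimTwo` (stmt-ValiantsHypothesis-8061), line `good_plane`,
towards the formalisation of "Theorem P" (`Cruxes/HessianRankCodimTwo/GoodPlanesLatinReduction.md`
§6): the mod-`p` structure of the permanent of the Latin block point and of its block values is
obtained by letting the `p`-group of cyclic shifts inside the row blocks act on cosets of
permutations; orbits that are not fixed points have cardinality divisible by `p` and contribute
nothing in characteristic `p`.  This file proves the general statement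
(`sum_eq_sum_fixedPoints_of_isPGroup`): for a finite `p`-group `G` acting on a finite type `α` and a
`G`-invariant weight `w : α → R` with values in a commutative ring of characteristic `p`,
`Σ_{a : α} w a = Σ_{a ∈ fixedPoints G α} w a`.
-/

open MulAction Finset

-- single-conjunct layout `Summits/ValiantsHypothesis/ValiantsHypothesis`: duplicated namespace by design
set_option linter.dupNamespace false

namespace Summit.ValiantsHypothesis.ValiantsHypothesis.Theorems.GrenetZeonHessianRankCodimTwo

variable {p : ℕ} {G : Type*} [Group G] {α : Type*} [MulAction G α] [Fintype α]
  {R : Type*} [CommRing R]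

/-- The sum of an invariant weight over one orbit is the orbit size times the weight. [folklore] -/
theorem sum_filter_orbitRel_eq [DecidableEq α] [DecidableRel (orbitRel G α)]
    (w : α → R) (hw : ∀ (g : G) (a : α), w (g • a) = w a) (b : α) [Fintype (orbit G b)] :
    ∑ a ∈ Finset.univ.filter (fun a => orbitRel G α a b), w a =
      (Fintype.card (orbit G b) : R) * w b := by
  have hconst : ∀ a ∈ Finset.univ.filter (fun a => orbitRel G α a b), w a = w b := by
    intro a ha
    obtain ⟨g, rfl⟩ := orbitRel_apply.mp (Finset.mem_filter.mp ha).2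
    exact hw g b
  rw [Finset.sum_congr rfl hconst, Finset.sum_const, nsmul_eq_mul]
  congr 2
  rw [← Set.toFinset_card]
  congr 1
  ext a
  simp [Set.mem_toFinset, mem_orbit_iff, orbitRel_apply]

/-- **Weighted orbit counting modulo `p`.** If a finite `p`-group `G` acts on a finite type `α`
and `w : α → R` is `G`-invariant with values in a commutative ring `R` in which `p = 0`, then
`Σ_a w a = Σ_{a fixed} w a`: non-trivial orbits have cardinality a positive power of `p`.
[folklore] -/
theorem sum_eq_sum_fixedPoints_of_isPGroup [Fintype G] [hp : Fact p.Prime] (hG : IsPGroup p G)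
    (hR : (p : R) = 0) (w : α → R) (hw : ∀ (g : G) (a : α), w (g • a) = w a)
    [DecidablePred fun a => a ∈ fixedPoints G α] :
    ∑ a, w a = ∑ a ∈ Finset.univ.filter (fun a => a ∈ fixedPoints G α), w a := by
  classical
  -- split the total sum along the orbit partition
  have hsplit : ∑ a, w a =
      ∑ q : Quotient (orbitRel G α), ∑ a ∈ Finset.univ.filter (fun a => Quotient.mk'' a = q), w a := by
    rw [← Finset.sum_fiberwise_of_maps_to (g := fun a => (Quotient.mk'' a : Quotient (orbitRel G α)))
      (t := Finset.univ) (fun _ _ => Finset.mem_univ _)]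
  rw [hsplit]
  -- the same for the fixed-point sum: a fixed point is alone in its orbit
  have hsplit' : ∑ a ∈ Finset.univ.filter (fun a => a ∈ fixedPoints G α), w a =
      ∑ q : Quotient (orbitRel G α),
        ∑ a ∈ (Finset.univ.filter (fun a => a ∈ fixedPoints G α)).filter
          (fun a => Quotient.mk'' a = q), w a := by
    rw [← Finset.sum_fiberwise_of_maps_to (g := fun a => (Quotient.mk'' a : Quotient (orbitRel G α)))
      (t := Finset.univ) (fun _ _ => Finset.mem_univ _)]
  rw [hsplit']
  refine Finset.sum_congr rfl fun q _ => ?_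
  induction q using Quotient.inductionOn' with
  | h b =>
    -- the fibre over the orbit of `b`
    have hfib : Finset.univ.filter (fun a => (Quotient.mk'' a : Quotient (orbitRel G α)) =
        Quotient.mk'' b) = Finset.univ.filter (fun a => orbitRel G α a b) := by
      ext a
      simp only [Finset.mem_filter, Finset.mem_univ, true_and]
      exact Quotient.eq''
    rw [hfib, sum_filter_orbitRel_eq w hw b]
    obtain ⟨k, hk⟩ := hG.card_orbit b
    rw [Nat.card_eq_fintype_card] at hk
    by_cases hb : b ∈ fixedPoints G α
    · -- singleton orbit
      have hk0 : Fintype.card (orbit G b) = 1 := mem_fixedPoints_iff_card_orbit_eq_one.mp hb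
      rw [hk0, Nat.cast_one, one_mul]
      have hfib' : (Finset.univ.filter (fun a => a ∈ fixedPoints G α)).filter
          (fun a => (Quotient.mk'' a : Quotient (orbitRel G α)) = Quotient.mk'' b) = {b} := by
        ext a
        simp only [Finset.mem_filter, Finset.mem_univ, true_and, Finset.mem_singleton]
        constructor
        · rintro ⟨-, h⟩
          have := Quotient.eq''.mp h
          obtain ⟨g, rfl⟩ := orbitRel_apply.mp this
          exact hb g
        · rintro rfl
          exact ⟨hb, rfl⟩
      rw [hfib', Finset.sum_singleton]
    · -- orbit of size `p^k`, `k ≥ 1`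
      have hk1 : k ≠ 0 := by
        rintro rfl
        rw [pow_zero] at hk
        exact hb (mem_fixedPoints_iff_card_orbit_eq_one.mpr hk)
      rw [hk, Nat.cast_pow, hR, zero_pow hk1, zero_mul]
      symm
      refine Finset.sum_eq_zero fun a ha => ?_
      exfalso
      simp only [Finset.mem_filter, Finset.mem_univ, true_and] at ha
      obtain ⟨hfix, hq⟩ := ha
      have := Quotient.eq''.mp hq
      obtain ⟨g, rfl⟩ := orbitRel_apply.mp this
      have hgb : g⁻¹ • (g • b) = g • b := hfix g⁻¹
      rw [inv_smul_smul] at hgb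
      rw [hgb] at hb
      exact hb hfix

end Summit.ValiantsHypothesis.ValiantsHypothesis.Theorems.GrenetZeonHessianRankCodimTwo
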